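/-
Origin: expansion seat `planner-pub-hodgecm-toy-g4-0`, handover #2 v2 2026-08-18T12:52:16Z (md5 214c0a1a) (`HOME/pub-hodgecm-toy-g4/lean/ToyG4/WeightDual3.lean`, md5 214c0a1a, 110 lines);
landed by the gen-8 packager in gate run 30 as `HodgeCM/Model/ToyG2/WeightDual3.lean` (import ^import ToyG4\.WeightDualUnit[ \t]*$→import HodgeCM.StubTree.WeightDualUnit ×1; import ^import ToyG3\.TrTopAll3[ \t]*$→import HodgeCM.Model.ToyG2.TrTopAll3 ×1).
-/
/-
Copyright: pub-hodgecm formalisation cell (harness21, 2026). New file (not vendored).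
Origin: HOME/pub-hodgecm-toy-g4/lean/ToyG4/WeightDual3.lean — session planner-pub-hodgecm-toy-g4-0 (unit pub-hodgecm-toy-g4),
EXPANSION part (e) CONSISTENCY WITNESS, generation 4.  Intended final place: `HodgeCM/Model/ToyG2/WeightDual3.lean`
(module `HodgeCM.Model.ToyG2.WeightDual3`).  WIP module names: this file `ToyG4.WeightDual3`; its import `ToyG4.WeightDualUnit`
= `HodgeCM.StubTree.WeightDualUnit` (this seat's first file, same run); `ToyG3.TrTopAll3` = toy-g3's
`HodgeCM.Model.ToyG2.TrTopAll3` (gate RUN 29 queue).  ADDITIVE: new declaration names only, nothing landed is edited,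
nothing imports this file.
-/
import Summits.HodgeConjecture.HodgeCM.Model.ToyG2.TrTopAll3
import Summits.HodgeConjecture.HodgeCM.Model.Toy.ToyFFacts
import Summits.HodgeConjecture.HodgeCM.StubTree.WeightDualUnit

/-!
# F6 `Fact_weightDual` is WITNESSED: it holds in `toyUniverse₃`, jointly with `ModelAxioms` 28/28

FACTS.md §1c lists F6 `Universe.Fact_weightDual` (two-sided, non-normalised weight duality on `H^•(∏ A_j, ℂ)`,
`StubTree/Qw8Geometric.lean`) as "class M, UNWITNESSED … NO toy witness — REFUTED in the exterior toy family"
(`HodgeCM.Toy.not_fact_weightDual`: the generation-1 model has `tr := 0`).  It is a binder of the geometric end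
states `Assembly.COR_CM_of_qw8Facts` / `COR_CM_of_geometricFacts` / `COR_CM_of_openInputsGeometric` (field
`OpenInputsGeometric.weightDual`).

`HodgeCM.StubTree.WeightDualUnit` (this seat) proves F6 IN FULL from `ModelAxioms`, N1 `Fact_cupExterior`,
F5 `Fact_cupAssoc`, M40 `Fact_dimProd`, T-CM `Fact_trTopCM` and M43 `Fact_unitH0`
(`Universe.weightDual_of_unitH0`); toy-g3 proved every one of these for the generation-3 model
(`fact3_cupExterior`, `fact3_cupAssoc`, `fact3_dimProd`, `fact3_trTopCM`, `fact3_unitH0`,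
`toyUniverse₃_modelAxioms_all`).  Hence:

* `fact3_weightDual`: F6 holds in `toyModel3With D traceSys pl` for EVERY Hodge datum `D` and block supply `pl`,
  given `ModelAxioms` (needed only through T-CM);
* `toyUniverse₃_weightDual_all (d t : ℚ) : (toyUniverse₃ d t).Fact_weightDual` — NO hypotheses;
* `exists_modelAxioms_and_weightDual : ∃ U, U.ModelAxioms ∧ U.Fact_weightDual` — F6 becomes WITNESSED (jointly
  with M1–M28), answering the F6 half of toy-g3's "still open (i)";
* `weightDual_independent₃`: F6 is INDEPENDENT of M1–M28 — it holds in `toyUniverse₃ 1 4` and fails in the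
  generation-1 `toyModel` (`Toy.not_fact_weightDual`), both models of `ModelAxioms`;
* `toyUniverse₃_geometricFacts_but_F2_F7_all` / `exists_geometricFacts_but_F2_F7`: of the eleven `Universe`-level
  binders of `COR_CM_of_openInputsGeometric` (`ModelAxioms`, `RealisationExistsFace`, N1–N4, F2, F4, F5, F6, F7) the
  model `toyUniverse₃ d t` (`1 ≤ d`, `t² = 16`) now witnesses NINE jointly — all but F2 `Fact_factorActDescends`
  and F7 `Fact_gysin` (F7 on `toyModel3With` is pv03-g7's claim, RUN 30; F2 is open for this model).

Scope (honest): `toyUniverse₃` is a TOY model (exterior algebras on lattices with a period-matrix Hodge datum);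
a joint witness shows that the binder lists above are jointly satisfiable with M1–M28 — nothing about the intended
model of complex CM abelian varieties, and nothing about PerL / [QW8] themselves (the statements under
adjudication).  NOT witnessed in this lineage so far: T `Fact_trTop` (all `X`; only T-CM is), F7 `Fact_gysin`
(pv03-g7's claim), F2 `Fact_factorActDescends` for `toyUniverse₃` (this seat's next file), hence the record
`OpenInputsGeometric`; the record `OpenInputs` IS witnessed (toy-g3, `Model/ToyG2/OpenInputsAll3`).
-/

noncomputable section

namespace HodgeCM

namespace ToyG2

open Toy

/-- **F6 in the generation-3 models** `toyModel3With D traceSys pl` (any Hodge datum, any block supply), from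
`ModelAxioms` (used for T-CM `fact3_trTopCM` and the weight-space theory). -/
theorem fact3_weightDual (D : HodgeData) (pl : GBlocks) (M : (toyModel3With D traceSys pl).ModelAxioms) :
    (toyModel3With D traceSys pl).Fact_weightDual :=
  Universe.weightDual_of_unitH0 M (fact3_cupExterior D traceSys pl) (fact3_cupAssoc D traceSys pl)
    (fact3_dimProd D traceSys pl) (fact3_trTopCM D pl M) (fact3_unitH0 D traceSys pl)

/-- **F6 in `toyUniverse₃ d t`**, given `ModelAxioms`. -/
theorem toyUniverse₃_weightDual (d t : ℚ) (M : (toyUniverse₃ d t).ModelAxioms) :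
    (toyUniverse₃ d t).Fact_weightDual :=
  fact3_weightDual exteriorHodgeData (gplOf d t) M

/-- **F6 in `toyUniverse₃ d t` — no hypotheses** (`toyUniverse₃_modelAxioms_all`, run 28). -/
theorem toyUniverse₃_weightDual_all (d t : ℚ) : (toyUniverse₃ d t).Fact_weightDual :=
  toyUniverse₃_weightDual d t (toyUniverse₃_modelAxioms_all d t)

/-- **F6 is WITNESSED jointly with `ModelAxioms`.** -/
theorem exists_modelAxioms_and_weightDual : ∃ U : Universe, U.ModelAxioms ∧ U.Fact_weightDual :=
  ⟨toyUniverse₃ 1 4, toyUniverse₃_modelAxioms_all 1 4, toyUniverse₃_weightDual_all 1 4⟩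

/-- **F6 is INDEPENDENT of `ModelAxioms`**: a model with F6 (`toyUniverse₃ 1 4`) and a model refuting F6
(the generation-1 exterior model `toyModel`, `tr = 0`). -/
theorem weightDual_independent₃ :
    (∃ U : Universe, U.ModelAxioms ∧ U.Fact_weightDual) ∧ ∃ U : Universe, U.ModelAxioms ∧ ¬ U.Fact_weightDual :=
  ⟨exists_modelAxioms_and_weightDual, toyModel, toyModel_modelAxioms, not_fact_weightDual exteriorHodgeData⟩

/-- Neither F6 nor its negation follows from `ModelAxioms`. -/
theorem weightDual_undecided_by_modelAxioms :
    (¬ ∀ U : Universe, U.ModelAxioms → U.Fact_weightDual) ∧ ¬ ∀ U : Universe, U.ModelAxioms → ¬ U.Fact_weightDual :=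
  ⟨fun h => not_fact_weightDual exteriorHodgeData (h toyModel toyModel_modelAxioms),
    fun h => h (toyUniverse₃ 1 4) (toyUniverse₃_modelAxioms_all 1 4) (toyUniverse₃_weightDual_all 1 4)⟩

/-- **Nine of the eleven `Universe`-level binders of `COR_CM_of_openInputsGeometric`, jointly, in `toyUniverse₃ d t`**
(`1 ≤ d`, `t² = 16`): `ModelAxioms`, `RealisationExistsFace`, N1–N4, F4, F5, F6 — plus M40 `Fact_dimProd` and T-CM
`Fact_trTopCM`.  Missing: F2 `Fact_factorActDescends`, F7 `Fact_gysin`. -/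
theorem toyUniverse₃_geometricFacts_but_F2_F7_all (d t : ℚ) (hd : 1 ≤ d) (ht : t ^ 2 = 16) :
    (toyUniverse₃ d t).ModelAxioms ∧ (toyUniverse₃ d t).RealisationExistsFace ∧
      (toyUniverse₃ d t).Fact_cupExterior ∧ (toyUniverse₃ d t).Fact_cup_hodge ∧ (toyUniverse₃ d t).Fact_pull_H0 ∧
      (toyUniverse₃ d t).Fact_hodge_F0 ∧ (toyUniverse₃ d t).Fact_cupAlg ∧ (toyUniverse₃ d t).Fact_cupAssoc ∧
      (toyUniverse₃ d t).Fact_weightDual ∧ (toyUniverse₃ d t).Fact_dimProd ∧ (toyUniverse₃ d t).Fact_trTopCM := by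
  obtain ⟨hM, hR, h1, h2, h3, h4, h5, h6, h7, h8⟩ := toyUniverse₃_genericFacts_but_gysin_all d t hd ht
  exact ⟨hM, hR, h1, h2, h3, h4, h5, h6, toyUniverse₃_weightDual_all d t, h7, h8⟩

/-- The existential form of `toyUniverse₃_geometricFacts_but_F2_F7_all` (witness `d = 1`, `t = 4`). -/
theorem exists_geometricFacts_but_F2_F7 : ∃ U : Universe,
    U.ModelAxioms ∧ U.RealisationExistsFace ∧ U.Fact_cupExterior ∧ U.Fact_cup_hodge ∧ U.Fact_pull_H0 ∧
      U.Fact_hodge_F0 ∧ U.Fact_cupAlg ∧ U.Fact_cupAssoc ∧ U.Fact_weightDual ∧ U.Fact_dimProd ∧ U.Fact_trTopCM :=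
  ⟨toyUniverse₃ 1 4, toyUniverse₃_geometricFacts_but_F2_F7_all 1 4 le_rfl (by norm_num)⟩

end ToyG2

end HodgeCM

end
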